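import Mathlib
import HarnessLib
import Summits.ValiantsHypothesis.ValiantsHypothesis.Theorems.MonotoneRestorationMultilinearRestorationQPValues
import Summits.ValiantsHypothesis.ValiantsHypothesis.Theorems.MonotoneRestorationMonotoneRestorationQPBeta
import Summits.ValiantsHypothesis.ValiantsHypothesis.Theorems.MonotoneRestorationMonotoneRestorationQPSparseRegime

/-!
# Two proved slices of the multilinear rung `MultilinearRestorationQP`

Helper file (`--supports stmt-ValiantsHypothesis-17621`) for the support item
`Summit.ValiantsHypothesis.ValiantsHypothesis.Theses.MonotoneRestoration.MultilinearRestorationQP`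
of route `MonotoneRestoration` (restoration at quasi-polynomial cost for matrix-symmetric families
over `ℝ≥0` of polynomial syntactically multilinear monotone size `smCircuitSize`).  Two sub-classes
of its hypothesis class restore unconditionally:

* `multilinearRestorationQP_of_biMultilinear` — the BI-MULTILINEAR slice (every monomial uses
  each row and each column at most once, i.e. nonnegative combinations `Σ_k a_k m_k` of the
  `k`-matching polynomials): `smCircuitSize (f n) ≤ (n+2)^c` gives monotone `complexity ≤ (n+2)^c`
  and `totalDegree ≤ n·n` (`MultilinearRung.complexity_le_of_smCircuitSize_le`,
  `MultilinearRung.totalDegree_le_of_smCircuitSize_le`), and Theorem β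
  (`monotoneRestorationQP_of_biMultilinear`: the Jerrum–Snir count forces degree `O(log n)`)
  concludes;
* `multilinearRestorationQP_of_polylogDegree` — the POLYLOG-DEGREE slice, an instance of the
  sparse regime `monotoneRestorationQP_of_polylogDegree` (no size hypothesis is needed there; it
  is recorded in the rung's signature shape so that the census of the item can cite it).

Census consequence for the item: a counterexample to the rung is a matrix-symmetric MULTILINEAR
family of polynomial syntactically multilinear monotone size whose monomials reuse rows or columns
and whose degree is `(log n)^{ω(1)}`.
-/

-- single-problem summit: `Summit.ValiantsHypothesis.ValiantsHypothesis.…` is the namespace by design (D-0017)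
set_option linter.dupNamespace false

noncomputable section

namespace Summit.ValiantsHypothesis.ValiantsHypothesis.Theorems

open Literature.Computability.AlgebraicComplexity MvPolynomial

/-- **The bi-multilinear slice of the multilinear rung restores.** `MultilinearRestorationQP`
with the extra hypothesis that every monomial of every `f n` uses each row and each column at most
once holds unconditionally (Theorem β after `smCircuitSize ⇒ complexity + degree`).
[cite: JerrumSnir1982, §4.3] -/
theorem multilinearRestorationQP_of_biMultilinear :
    ∀ f : (n : ℕ) → MvPolynomial (Fin n × Fin n) NNReal,
    (∀ (n : ℕ) (σ τ : Equiv.Perm (Fin n)),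
      MvPolynomial.rename (fun p : Fin n × Fin n => (σ p.1, τ p.2)) (f n) = f n) →
    (∀ n, ∀ m ∈ (f n).support, (∀ i, rowCount m i ≤ 1) ∧ (∀ j, colCount m j ≤ 1)) →
    (∃ c : ℕ, ∀ n : ℕ, smCircuitSize (k := NNReal) (f n) ≤ ((n + 2) ^ c : ℕ)) →
    ∃ c : ℕ, ∀ n : ℕ, ∃ (G : Type) (_ : Fintype G)
      (C : LabelledArithCircuit ℂ (Fin n × Fin n) Unit G),
      C.IsSymmetric (Equiv.Perm (Fin n)) ∧
      C.eval (C.output ()) = MvPolynomial.map (Complex.ofRealHom.comp NNReal.toRealHom) (f n) ∧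
      Fintype.card G ≤ 2 ^ ((Nat.log 2 n + c) ^ c) := by
  intro f hsym hbi hsm
  obtain ⟨c, hc⟩ := hsm
  refine monotoneRestorationQP_of_biMultilinear f hsym hbi ⟨max c 2, fun n => ⟨?_, ?_⟩⟩
  · calc (f n).totalDegree ≤ Fintype.card (Fin n × Fin n) :=
          MultilinearRung.totalDegree_le_of_smCircuitSize_le (hc n)
      _ = n * n := by simp
      _ ≤ (n + 2) ^ 2 := by nlinarith
      _ ≤ (n + 2) ^ max c 2 := Nat.pow_le_pow_right (by omega) (le_max_right _ _)
  · exact (MultilinearRung.complexity_le_of_smCircuitSize_le (hc n)).trans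
      (Nat.pow_le_pow_right (by omega) (le_max_left _ _))

/-- **The polylog-degree slice of the multilinear rung restores** — an instance of the sparse
regime `monotoneRestorationQP_of_polylogDegree` (the size hypothesis is not used: every
matrix-symmetric family of degree `≤ (log₂ n + c)^c` has `≤ (n² + 1)^deg` monomials and the orbit
circuit is quasi-polynomial). [folklore] -/
theorem multilinearRestorationQP_of_polylogDegree :
    ∀ f : (n : ℕ) → MvPolynomial (Fin n × Fin n) NNReal,
    (∀ (n : ℕ) (σ τ : Equiv.Perm (Fin n)),
      MvPolynomial.rename (fun p : Fin n × Fin n => (σ p.1, τ p.2)) (f n) = f n) →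
    (∃ c : ℕ, ∀ n : ℕ, (f n).totalDegree ≤ (Nat.log 2 n + c) ^ c ∧
      smCircuitSize (k := NNReal) (f n) ≤ ((n + 2) ^ c : ℕ)) →
    ∃ c : ℕ, ∀ n : ℕ, ∃ (G : Type) (_ : Fintype G)
      (C : LabelledArithCircuit ℂ (Fin n × Fin n) Unit G),
      C.IsSymmetric (Equiv.Perm (Fin n)) ∧
      C.eval (C.output ()) = MvPolynomial.map (Complex.ofRealHom.comp NNReal.toRealHom) (f n) ∧
      Fintype.card G ≤ 2 ^ ((Nat.log 2 n + c) ^ c) :=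
  fun f hsym ⟨c, hc⟩ => monotoneRestorationQP_of_polylogDegree f hsym ⟨c, fun n => (hc n).1⟩

end Summit.ValiantsHypothesis.ValiantsHypothesis.Theorems

end
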